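import Summits.BirchSwinnertonDyer.BirchSwinnertonDyer.Theorems.KatoDescentPotSupersingularReducibleFineSelmerMuZeroCharForm
import Summits.BirchSwinnertonDyer.BirchSwinnertonDyer.Theorems.KatoDescentPotSupersingularReducibleFineSelmerImaginaryQuadraticThree
import Summits.BirchSwinnertonDyer.BirchSwinnertonDyer.Theorems.KatoDescentTamePotSupersingularCartanMuRoadFukudaDoorsTprime
import Literature.NumberTheory.IwasawaTheory.ClassicalMuVanishesOddCharacterDescent
import Literature.NumberTheory.IwasawaTheory.ClassGroupPRankSmallRankCriterion
import Literature.NumberTheory.IwasawaTheory.ClassicalMuInvariantOnePrimeProofs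
import Literature.NumberTheory.EllipticCurves.DivisionFieldReducibleBorelExponent
import Literature.NumberTheory.EllipticCurves.FineSelmerCongruentCurvesNumberFieldProofs
import HarnessLib

/-!
# The per-row `μ`-door of crux M at every odd `p` with the ONE-LAYER SMALL-RANK criterion: (A) at `(W, p)` on a reducible row as
# soon as every imaginary cyclic subfield `M` of the Borel field passes Iwasawa 1956, OR Fukuda's rank stability, OR
# `rank_p Cl(M_j) < p^j − 1` at ONE layer `j` (route-free helper for crux M = stmt-BirchSwinnertonDyer-19196 `ReducibleKatoMember`,
# K9 / K8-t′; seat `bsd-potss-rkm` g38)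

WHY.  Generation 37 reduced the `μ`-input of crux M / statement (A) at `(W, p)` on a reducible row (`W[p]^{ss} = χ₁ ⊕ χ₂`) to
«`μ_p(M) = 0` for the IMAGINARY CYCLIC subfields `M` of the Borel field `ℚ(χ₁, χ₂)`» and gave two per-field doors: Iwasawa 1956
(`p ∤ h(M)`, one prime above `p`) and Fukuda's Thm. 1 (2) (`rank_p Cl(M_{n+1}) = rank_p Cl(M_n)`).  At `p = 5` the K8-t′ X3 census left
106 rows on 19 fields where both fail at the computable layers (`ℚ(i)` alone carries 42 rows: `5` splits, the `5`-rank jumps `0 → 1`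
at layer `0 → 1`, and layer `2` has degree `50`).  The literature seat `bsd-potss-conjA-anchor` (g20) has meanwhile PROVED the one-layer
small-rank criterion `IwasawaTheory.classicalMuVanishes_of_lt_pow_sub_one` (Washington §13.3 at finite level): under Fukuda's index
`n₀`, `rank_p Cl(M_{n+j}) < p^j − 1` at a SINGLE layer forces bounded `p`-ranks and `μ = 0` — growth below that layer is allowed.
For every subfield of the Borel field Fukuda's index is `0` (`p ∤ #Gal(ℚ(χ₁,χ₂)/ℚ)`, tree
`CartanMuRoadFukudaDoorsTprime.totallyRamifiedFrom_zero_of_isCyclotomic_of_algHom_normal_of_not_dvd_card`), so the criterion reads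
**`rank_p Cl(M_j) < p^j − 1` for one `j ≥ 1`** — at `p = 5`, `j = 1`: `rank₅ Cl(M₁) ≤ 3` for the degree-`5[M:ℚ]` field `M₁ = M·ℚ₁`.
This file wires that third door into g37's theorem:

* `classicalMuVanishes_of_classGroupPRank_lt_of_algHom` — `μ_p(M) = 0` for a number field `M` mapping into a normal `L ⊆ ℚ̄` with
  `p ∤ #Gal(L/ℚ)`, from `rank_p Cl(M_j) < p^j − 1` at one layer of a cyclotomic `ℤ_p`-extension (L10 ∘ Fukuda index `0`);
* `fineSelmerDual_moduleFinite_of_not_irreducible_of_forall_doors` — **THE PER-ROW DOOR, THREE-WAY FORM**: (A) at `(W, p)` when each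
  imaginary cyclic `M ⊆ ℚ(χ₁,χ₂)` passes Iwasawa 1956 ∨ (for every cyclotomic `κM`: Fukuda stability at some layer ∨ small rank at some layer);
* `fineSelmerDual_moduleFinite_of_not_irreducible_of_forall_iwasawa1956_or_rankOne_le` — the `j = 1` reading the census certifies:
  Iwasawa 1956 ∨ `rank_p Cl(M₁) ≤ p − 2`.

CENSUS (kit job of this generation, evidence on the item): every one of g37's 42 residual `p = 5` fields has `rank₅ Cl(M₁) ∈ {0,1,2,3}`, so
all 591 K8-t′ X3 reducible rows at `p = 5` have a per-row `μ`-certificate (443 by Iwasawa 1956, the rest by this door; the quadratic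
ones certified, the quartic ones under GRH); the `p = 3` mirror fields of g36/g37 with `rank₃ Cl(M₁) = 1` are certified at degree `6`.
HONEST FRAMING.  Theorems only; route-free; closes nothing (crux M stays cite-level over Fine, H2X⁺, modularity and — class-wide —
`H_IC ⊊ FW`); no class group is computed in Lean (the per-field facts are hypotheses the record lanes discharge per row); BSD is proved for no
curve.  References: [Washington1997] §13.3 Lemma 13.18, Prop. 13.22–13.23; [Fukuda1994] Thm. 1; [Greenberg2001IwasawaPastPresent] Prop. 2.1;
[CoatesSujatha2005] Cor. 3.6; [Wuthrich2014] L. 14; [Lang1990] Ch. 13 §2 Thm. 2.1 (i).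
-/

-- the summit and its single problem are both named `BirchSwinnertonDyer` (registry layout D-0017)
set_option linter.dupNamespace false
set_option autoImplicit false

noncomputable section

open scoped Classical NumberField
open Field NumberField NumberField.InfinitePlace IsDedekindDomain IntermediateField WeierstrassCurve
open Literature.NumberTheory.EllipticCurves Literature.NumberTheory.EllipticCurves.GreenbergSelmer
open Literature.NumberTheory.GaloisRepresentations Literature.NumberTheory.IwasawaTheory
open Literature.NumberTheory.IwasawaTheory.ClassicalMuVanishesUnramifiedClasses
open Summit.BirchSwinnertonDyer.BirchSwinnertonDyer.Theorems

namespace Summit.BirchSwinnertonDyer.BirchSwinnertonDyer.Theorems.ReducibleFineSelmerImaginaryCyclicSmallRank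

/-! ## §1 The one-layer small-rank criterion below a normal field of degree prime to `p` -/

/-- **`μ_p(M) = 0` from ONE layer of small rank, Fukuda index discharged.**  `M` a number field with a `ℚ`-algebra map into a normal
`L ⊆ ℚ̄` with `p ∤ #Gal(L/ℚ)`, `κM` a CYCLOTOMIC `ℤ_p`-extension of `M`: if `rank_p Cl(M_j) < p^j − 1` for some `j`, then
`ClassicalMuVanishes κM` (growth form).  Fukuda's index is `0` for such `M` (every prime above `p` is totally ramified in `M_∞/M`), so the
tree's `classicalMuVanishes_of_lt_pow_sub_one` applies with `n₀ = n = 0`.  (`p = 5`, `j = 1`: `rank₅ Cl(M₁) ≤ 3`; `p = 3`, `j = 1`: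
`rank₃ Cl(M₁) ≤ 1`, `j = 2`: `rank₃ Cl(M₂) ≤ 7`.)
[cite: Washington1997, §13.3 Lemma 13.18, Prop. 13.22 and Prop. 13.23] [cite: Fukuda1994, p. 264 (the index `n₀`) and Thm. 1 (proof)] -/
theorem classicalMuVanishes_of_classGroupPRank_lt_of_algHom (M : Type) [Field M] [NumberField M]
    (L : IntermediateField ℚ (AlgebraicClosure ℚ)) [Normal ℚ L] (p : ℕ) [Fact p.Prime]
    (hd : ¬ p ∣ Nat.card (L ≃ₐ[ℚ] L)) (φ : M →ₐ[ℚ] L) (κM : ZpExtension M p) (hκM : κM.IsCyclotomic)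
    {j : ℕ} (hj : classGroupPRank κM j < p ^ j - 1) : ClassicalMuVanishes κM :=
  classicalMuVanishes_of_lt_pow_sub_one κM
    (CartanMuRoadFukudaDoorsTprime.totallyRamifiedFrom_zero_of_isCyclotomic_of_algHom_normal_of_not_dvd_card M L p hd φ κM hκM)
    le_rfl (j := j) (by rwa [zero_add])

/-- The same with the Fukuda alternative folded in: `rank_p Cl(M_{n+1}) = rank_p Cl(M_n)` at some layer OR `rank_p Cl(M_j) < p^j − 1` at
some layer gives `μ_p(M) = 0` (Fukuda Thm. 1 (2) `_holds` ∨ L10, index `0`). [cite: Fukuda1994, Thm. 1 (2), p. 264]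
[cite: Washington1997, §13.3 Prop. 13.23] -/
theorem classicalMuVanishes_of_fukuda_or_classGroupPRank_lt_of_algHom (M : Type) [Field M] [NumberField M]
    (L : IntermediateField ℚ (AlgebraicClosure ℚ)) [Normal ℚ L] (p : ℕ) [Fact p.Prime]
    (hd : ¬ p ∣ Nat.card (L ≃ₐ[ℚ] L)) (φ : M →ₐ[ℚ] L) (κM : ZpExtension M p) (hκM : κM.IsCyclotomic)
    (h : (∃ n : ℕ, classGroupPRank κM (n + 1) = classGroupPRank κM n) ∨ ∃ j : ℕ, classGroupPRank κM j < p ^ j - 1) :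
    ClassicalMuVanishes κM := by
  rcases h with ⟨n, hn⟩ | ⟨j, hj⟩
  · exact classicalMuVanishes_of_classGroupPRank_succ_eq' κM
      (CartanMuRoadFukudaDoorsTprime.totallyRamifiedFrom_zero_of_isCyclotomic_of_algHom_normal_of_not_dvd_card M L p hd φ κM hκM)
      (Nat.zero_le n) hn
  · exact classicalMuVanishes_of_classGroupPRank_lt_of_algHom M L p hd φ κM hκM hj

/-! ## §2 THE PER-ROW DOOR, three-way form: Iwasawa 1956 ∨ Fukuda ∨ one small layer, on the imaginary cyclic subfields -/

/-- **THE PER-ROW DOOR at every odd `p`, THREE-WAY FORM: (A) at `(W, p)` when each IMAGINARY CYCLIC subfield `M` of the Borel field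
`ℚ(χ₁, χ₂)` passes EITHER Iwasawa 1956 (`p ∤ #Cl(M)`, exactly one prime above `p`) OR, for every cyclotomic `ℤ_p`-extension `κM`, Fukuda's
rank stability `rank_p Cl(M_{n+1}) = rank_p Cl(M_n)` at some layer OR the one-layer small-rank test `rank_p Cl(M_j) < p^j − 1` at some layer.**
g37's odd-character reflection descent supplies `μ_p(ℚ(χ₁,χ₂)) = 0` from the `μ_p(M) = 0`, and g33's dévissage with the char-form `μ = 0`
(g34, proved) gives (A).  The third door is what clears the `p = 5` residue of g37's census (`ℚ(i)`: `rank₅ Cl(ℚ(i)·ℚ₁) = 1 ≤ 3`).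
[cite: Washington1997, §7.5, §10.2 Thm. 10.11, §13.3 Prop. 13.23] [cite: Fukuda1994, Thm. 1 (2), p. 264]
[cite: Greenberg2001IwasawaPastPresent, Prop. 2.1 p. 339] [cite: CoatesSujatha2005, Cor. 3.6] [cite: Wuthrich2014, Lemma 14 (p. 396)] -/
theorem fineSelmerDual_moduleFinite_of_not_irreducible_of_forall_doors {p : ℕ} [hp : Fact p.Prime] (hp2 : p ≠ 2)
    (W : WeierstrassCurve ℚ) [W.IsElliptic] (κ : ZpExtension ℚ p) (hκ : κ.IsCyclotomic)
    (C : AddSubgroup (W.geomTorsion ((p : ℕ) : ℤ)))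
    (hC : ∀ (σ : absoluteGaloisGroup ℚ) (x : W.geomTorsion ((p : ℕ) : ℤ)), x ∈ C → σ • x ∈ C) (h1 : C ≠ ⊥) (h2 : C ≠ ⊤)
    (hrows : haveI : NeZero p := ⟨hp.out.ne_zero⟩
      ∀ M : IntermediateField ℚ ↥(W.borelField C), IsCyclic (↥M ≃ₐ[ℚ] ↥M) → ¬ IsTotallyReal ↥M →
        (¬ p ∣ Nat.card (ClassGroup (𝓞 ↥M)) ∧
          ∃! v : HeightOneSpectrum (𝓞 ↥M), ((p : ℕ) : 𝓞 ↥M) ∈ v.asIdeal) ∨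
        ∀ κM : ZpExtension ↥M p, κM.IsCyclotomic →
          (∃ n : ℕ, classGroupPRank κM (n + 1) = classGroupPRank κM n) ∨
            ∃ j : ℕ, classGroupPRank κM j < p ^ j - 1) :
    ∃ (γ : absoluteGaloisGroup ℚ) (D : W.FineSelmerDualData κ γ),
      Module.Finite ℤ_[p] (RestrictScalars ℤ_[p] (IwasawaAlgebra p) D.X) := by
  haveI : NeZero p := ⟨hp.out.ne_zero⟩
  haveI : FiniteDimensional ℚ (W.borelField C) := finiteDimensional_borelField C
  haveI : NumberField (W.borelField C) := NumberField.mk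
  haveI : IsGalois ℚ (W.borelField C) := isGalois_borelField hC
  have hV : Nat.card (W.geomTorsion ((p : ℕ) : ℤ)) = p ^ 2 := W.natCard_geomTorsion_eq_sq_of_charZero hp.out
  have hcard : Nat.card C = p := card_eq_of_ne_bot_of_ne_top hV h1 h2
  haveI : IsAbelianGalois ℚ (W.borelField C) := isAbelianGalois_borelField hC hcard hV
  obtain ⟨ζ, hζ⟩ := W.exists_isPrimitiveRoot_borelField C h1 h2
  haveI : IsTotallyComplex ↥(W.borelField C) :=
    ReducibleFineSelmerImaginaryQuadraticThree.isTotallyComplex_of_isPrimitiveRoot hζ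
      (lt_of_le_of_ne hp.out.two_le (Ne.symm hp2))
  have hexp : Monoid.exponent (↥(W.borelField C) ≃ₐ[ℚ] ↥(W.borelField C)) ∣ p - 1 := W.exponent_gal_borelField_dvd hC h1 h2
  -- `p ∤ #Gal(ℚ(χ₁,χ₂)/ℚ)` (`[ℚ(χ₁,χ₂) : ℚ] ∣ (p-1)²`): Fukuda's index is `0` for every subfield
  have hdeg : ¬ p ∣ Nat.card (↥(W.borelField C) ≃ₐ[ℚ] ↥(W.borelField C)) := by
    rw [IsGalois.card_aut_eq_finrank]
    intro h
    have hdvd := h.trans (W.finrank_borelField_dvd hC h1 h2)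
    have h1' : p ∣ p - 1 := (Nat.Prime.dvd_mul hp.out).mp (by simpa [sq] using hdvd) |>.elim id id
    have h2' := Nat.le_of_dvd (Nat.sub_pos_of_lt hp.out.one_lt) h1'
    have h3' := hp.out.one_lt
    omega
  rw [LimSujatha2018.fineSelmerDual_moduleFinite_iff_finite_fineSelmerInfty_torsion W hp2 κ hκ]
  refine ReducibleFineSelmerMuZeroCharForm.fineSelmerInfty_torsion_finite_of_reducible
    classicalMuVanishes_finite_unramifiedClasses_holds W hp2 κ hκ C hC h1 h2 fun κF hκF => ?_
  refine classicalMuVanishes_of_isCyclotomic_of_imaginaryCyclicSubfields_rat hp2 ↥(W.borelField C) hζ hexp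
    (fun M hcyc hnr κM hκM => ?_) κF hκF
  haveI : NumberField ↥M := NumberField.mk
  rcases hrows M hcyc hnr with ⟨hh, hv⟩ | hF
  · have hh' : ¬ p ∣ NumberField.classNumber ↥M := by rwa [NumberField.classNumber, ← Nat.card_eq_fintype_card]
    exact classicalMuVanishes_of_classNumberPExp_eq_zero
      iwasawa1956_classNumberPExp_eq_zero_of_not_dvd_classNumber_of_unique_prime_holds hh' hv κM
  · exact classicalMuVanishes_of_fukuda_or_classGroupPRank_lt_of_algHom ↥M (W.borelField C) p hdeg
      (IntermediateField.val M) κM hκM (hF κM hκM)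

/-! ## §3 The `j = 1` reading certified by the census: Iwasawa 1956 ∨ `rank_p Cl(M₁) ≤ p − 2` -/

/-- **THE PER-ROW DOOR, LAYER-ONE READING: (A) at `(W, p)` when each imaginary cyclic subfield `M` of the Borel field passes Iwasawa 1956
OR has `rank_p Cl(M₁) ≤ p − 2` for every cyclotomic `ℤ_p`-extension (`M₁ = M·ℚ₁`, `ℚ₁` the degree-`p` subfield of `ℚ(ζ_{p²})`).**  At
`p = 5`: `rank₅ Cl(M₁) ≤ 3` — true for all 42 residual fields of g37's K8-t′ X3 census (13 imaginary quadratics with `5` split, e.g. `ℚ(i)`,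
`ℚ(√−11)`, `ℚ(√−6)`, and the cyclic quartic CM fields with `5 ∣ h`).  At `p = 3`: `rank₃ Cl(M₁) ≤ 1`.
[cite: Washington1997, §13.3 Prop. 13.23] [cite: Greenberg2001IwasawaPastPresent, Prop. 2.1 p. 339] [cite: CoatesSujatha2005, Cor. 3.6] -/
theorem fineSelmerDual_moduleFinite_of_not_irreducible_of_forall_iwasawa1956_or_rankOne_le {p : ℕ} [hp : Fact p.Prime]
    (hp2 : p ≠ 2) (W : WeierstrassCurve ℚ) [W.IsElliptic] (κ : ZpExtension ℚ p) (hκ : κ.IsCyclotomic)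
    (C : AddSubgroup (W.geomTorsion ((p : ℕ) : ℤ)))
    (hC : ∀ (σ : absoluteGaloisGroup ℚ) (x : W.geomTorsion ((p : ℕ) : ℤ)), x ∈ C → σ • x ∈ C) (h1 : C ≠ ⊥) (h2 : C ≠ ⊤)
    (hrows : haveI : NeZero p := ⟨hp.out.ne_zero⟩
      ∀ M : IntermediateField ℚ ↥(W.borelField C), IsCyclic (↥M ≃ₐ[ℚ] ↥M) → ¬ IsTotallyReal ↥M →
        (¬ p ∣ Nat.card (ClassGroup (𝓞 ↥M)) ∧
          ∃! v : HeightOneSpectrum (𝓞 ↥M), ((p : ℕ) : 𝓞 ↥M) ∈ v.asIdeal) ∨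
        ∀ κM : ZpExtension ↥M p, κM.IsCyclotomic → classGroupPRank κM 1 ≤ p - 2) :
    ∃ (γ : absoluteGaloisGroup ℚ) (D : W.FineSelmerDualData κ γ),
      Module.Finite ℤ_[p] (RestrictScalars ℤ_[p] (IwasawaAlgebra p) D.X) := by
  have hp2' : 2 ≤ p := hp.out.two_le
  refine fineSelmerDual_moduleFinite_of_not_irreducible_of_forall_doors hp2 W κ hκ C hC h1 h2 fun M hcyc hnr => ?_
  rcases hrows M hcyc hnr with h | h
  · exact Or.inl h
  · refine Or.inr fun κM hκM => Or.inr ⟨1, ?_⟩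
    have := h κM hκM
    rw [pow_one]
    omega

end Summit.BirchSwinnertonDyer.BirchSwinnertonDyer.Theorems.ReducibleFineSelmerImaginaryCyclicSmallRank

end
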